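import Mathlib
import Literature.MathematicalPhysics.QuantumFieldTheory.Balaban1983to89.B12SmallFieldRegion255
import Literature.MathematicalPhysics.QuantumFieldTheory.Balaban1983to89.BlockAveragingFederbushAnalytic

/-!
# `Balaban1983to89.B12Average012Analytic` — [Balaban1987RG1] p. 253 «we assume that it is an analytic function» /
# [Balaban1985Averaging] Prop. 3 (121) «Q(V₀, A, c) = (1/i) log (V̄₁)_c is an analytic function of A»: the averaged
# contour variables (0.11), the average (0.12) and (2.4)'s `Q̃_V(B′)` of the b12 lineage are COMPLEX-ANALYTIC in
# the configuration / in `B′`, and the linear part `LQ̃` of p. 267 is LINEAR in `B′` — PROVED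

HONEST FRAMING (cell `lit-balaban`, verbatim): statement-level skeleton of published theorems with citation tags;
proofs where landed; nothing here is a claim about the Yang–Mills mass gap.

CITATION HEADER.  T. Bałaban, *Renormalization group approach to lattice gauge field theories. I*, Commun. Math.
Phys. **109** (1987) 249–301, doi:10.1007/bf01215223 [Balaban1987RG1] (cell paper B12 = «[I]»): p. 253 (the
average `M` «is an analytic function»), (0.11)–(0.12) pp. 253–254, (2.4) p. 266 and p. 267 («LQ̃B′ + C̃(B′)»); PDF
held `paper:balaban1987-cmp109-rg-i-small-field` (journal page = PDF page + 248), pp. 253–254 re-read this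
generation.  [12] = [B7] = [Balaban1985Averaging], Commun. Math. Phys. **98** (1985) 17–51, Proposition 3 (121)
p. 36 («then Q(V₀, A, c) is an analytic function of A») — tree leaf `B7.Prop3Printed` (field `IsAnalyticQ`); the
model-average twin is `B7Prop3GeneralAnalytic` (NE7c lineage), whose composition pattern this file follows.  Unit
`lit-balaban-r09` gen 9 (display owner of CMP 109; TAKING line `HOME/STATUS.md` 2026-08-21T09:3xZ), HOME
`run/shared/lean/pub/lit-balaban/`; SKELETON rows `B12.Eq0.5-0.7`/`B12.Eq0.11` (analyticity of M), `B12.Eq0.12`,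
`B12.Eq2.4`, `B12.Def@267` (cells only).

WHAT IS PRINTED (verbatim).  [I] p. 253: *«We denote it by M({U_j}), and we assume that it is an analytic function
having the following properties …»*.  [B7] p. 36: *«Let us define Q(V₀, A, c) = (1/i) log (V̿₁)_c, (121) then Q(V₀,
A, c) is an analytic function of A and from (120) it follows that its Taylor expansion begins with a first-order
polynomial.»*  [I] p. 254: *«all results of the paper [12] are valid for it [the average (0.12)]»*; p. 267: *«we
make a change of variables … LQ̃B′ + C̃(B′)»* (the linear part `LQ̃` of `Q̃`).

DICTIONARY print → Lean (all PRE-EXISTING).  A configuration depending analytically on parameters ↦ a family `U : E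
→ (ZdEdge d → 𝔸ˣ)` over a complex normed space `E` with every bond variable `t ↦ U_t(b) ∈ 𝔸` analytic at `t₀`
(Mathlib `AnalyticAt ℂ`; the pattern of `B7Prop3GeneralAnalytic`, which avoids norming the infinite product of bond
variables); (0.11) `𝐔(q,x)` ↦ `B12ContourAverage253.Tavg`; (0.12) `Ū(c)` ↦ `B12SmallFieldRegion255.avgBar`; `V′V`,
`V′ = exp(iB′)` ↦ `B12AverageCorridor267.pert B′ V`; (2.4) `Q̃_V(B′)(c)` ↦ `B12AverageCorridor267.Qtilde L 𝐔 V B′ c`;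
«LQ̃B′» ↦ `B12AverageCorridor267.LQ L 𝐔 V B′ c = d/ds|₀ Q̃_V(sB′)(c)`; `log` ↦ `MatrixLog.mlog`.

THE ARGUMENT FORMALISED (composition of analytic maps).  § 1: inverses of analytic unit families (Mathlib
`analyticAt_inverse`), parallel transport along a fixed word, the contour transporters `U(Γ^π_{q,x})`, the straight
transporters.  § 2: the relative contour family `{U(Γ^π)U(Γ^1)⁻¹}_π` is analytic into the finite product
`Perm(Fin d) → 𝔸`; Federbush's solution of (0.10) is analytic in the family at every `1/100`-small family (the tree's
analytic implicit function theorem `FederbushMean.analyticAt_fedSol`, `BlockAveragingFederbushAnalytic`), the family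
being `(dL)²ε₀ < 1/100`-small at a regular configuration (`B12ContourAverage253.rel_permT_small`); hence `𝐔(q,x) =
X⁻¹U(Γ_{q,x})` is analytic (`analyticAt_Tavg`).  § 3: the loops of (0.12) are analytic and lie in `‖W − 1‖ ≤ ω_A =
10(dL)²ε₀ < 1` where the series logarithm is analytic (`MatrixLog.analyticAt_mlog`); block sum, `exp`
(`NormedSpace.exp_analytic`) and the factor `U(c)` give `analyticAt_avgBar`.  § 4: `B′ ↦ V′V` is analytic bondwise,
equal to `V` at `B′ = 0`, so `Q̃_V(B′_t)(c) = (−i) log(Ū(V′V)(c)Ū(V)(c)⁻¹)` is analytic at any `t₀` with `B′_{t₀}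
= 0` (`analyticAt_Qtilde`; the logarithm's argument is `1` there).  § 5: with `E = ℂ`, `s ↦ Q̃_V(sB′)(c)` is
differentiable at `0`, so `LQ̃B′` is its derivative (`hasDerivAt_Qtilde_line`); with `E = ℂ²`, `(s,r) ↦ Q̃_V(sB′₁ +
rB′₂)(c)` has a Fréchet derivative `D` at `0` and `LQ̃(B′₁ + B′₂) = D(1,1) = D(1,0) + D(0,1) = LQ̃B′₁ + LQ̃B′₂`
(`LQ_add`, chain rule along the three lines); `LQ̃(aB′) = aLQ̃B′` by the chain rule along `s ↦ sa` (`LQ_smul`).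

WHAT IS PROVED (kernel-checked, no `sorry`, axioms `propext`, `Classical.choice`, `Quot.sound`; NO definition, NO
`Prop` placeholder, net new unproved facts 0): `analyticAt_units_inv`, `analyticAt_stepHol`, `analyticAt_hol`,
`analyticAt_permT`, `analyticAt_lineR`, `analyticAt_Ustr`, `analyticAt_rel_permT`, **`analyticAt_Tavg`**,
`analyticAt_loopW_Tavg`, **`analyticAt_avgBar`**, `analyticAt_pert`, **`analyticAt_Qtilde`**, `hasDerivAt_Qtilde_line`,
**`LQ_add`**, **`LQ_smul`**.

DIVERGENCES FROM PRINT / WHAT IS NOT PROVED (honest scope).  (a) Analyticity is proved AT regular `U1`-valued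
configurations (`(dL)²ε₀ < 1/100`, strict, `d ≥ 1`) for analytic parametrisations — the germ statement; no explicit
polydisc of analyticity in `A`/`B′` (print's `|A| < α₁ ≤ c₃`) and no bound on `Q̃` there are given, hence NOT the
remainder estimate (123) `|C(V₀, A, c)| ≤ C₁L²|A|²` nor (126); those, for the model average, are `B7Prop3Flat`/
`B7Prop3GeneralLinear`'s.  (b) `Gᶜ`-valuedness of `M` and the Lie-algebra reading of `(1/i) log` are not separated
(series logarithm in `𝔸`, as in the lineage).  (c) `ℤᵈ` corner cubes and the lineage's (0.10)–(0.12)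
(`B12ContourAverage253` (a)–(c)).  (d) The linearity of `LQ̃` is for the family (0.11) (`𝒯 = Tavg`); for the
abstract block-local families of `B12AverageCorridor267` it remains unproved there (no analyticity axiom on `𝒯`).
-/

noncomputable section

open NormedSpace Finset

namespace Literature.MathematicalPhysics.QuantumFieldTheory.Balaban1983to89.B12Average012Analytic

open Literature.MathematicalPhysics.QuantumLattice (ZdEdge blockMap blockSites mem_blockSites_iff plaquetteHolonomyZd)
open B7Prop1Explicit (U1 mem_U1 e hol hol_nil hol_cons stepHol stepHol_true stepHol_false Letter)
open B7Eq61Linearization (lineR pathProd pathProd_zero pathProd_succ)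
open B12AverageCorridor267 (Ustr loopW loopW_def avgM expU val_expU pert pert_apply pert_zero Qtilde LQ)
open B12ContourAverage253 (rel fedUnit val_fedUnit permT permT_one Tavg Tavg_eq rel_permT_small omegaA
  norm_loopW_Tavg_sub_one_le_local)
open B12SmallFieldRegion255 (avgBar)
open FederbushMean (fedSol analyticAt_fedSol)
open MatrixLog (mlog analyticAt_mlog)

variable {d : ℕ}
variable {E : Type*} [NormedAddCommGroup E] [NormedSpace ℂ E]
variable {𝔸 : Type*} [NormedRing 𝔸] [NormedAlgebra ℂ 𝔸] [NormOneClass 𝔸] [CompleteSpace 𝔸] {L : ℕ}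

/-! ## § 1  Analytic families of units: inverses, transporters, straight contours -/

omit [NormOneClass 𝔸] in
/-- [cite: Balaban1985Averaging, (9) p.18] the inverse of an analytic family of units is analytic
(`Ring.inverse` is analytic at every unit, Mathlib `analyticAt_inverse`; elementary API). -/
theorem analyticAt_units_inv {F : E → 𝔸ˣ} {t₀ : E} (h : AnalyticAt ℂ (fun t => ((F t : 𝔸ˣ) : 𝔸)) t₀) :
    AnalyticAt ℂ (fun t => (((F t)⁻¹ : 𝔸ˣ) : 𝔸)) t₀ := by
  have e : (fun t => (((F t)⁻¹ : 𝔸ˣ) : 𝔸)) = fun t => Ring.inverse ((F t : 𝔸ˣ) : 𝔸) :=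
    funext fun t => (Ring.inverse_unit (F t)).symm
  rw [e]
  exact (analyticAt_inverse (𝕜 := ℂ) (F t₀)).fun_comp_of_eq h rfl

section Transport

variable (U : E → ZdEdge d → 𝔸ˣ) {t₀ : E} (hU : ∀ b, AnalyticAt ℂ (fun t => ((U t b : 𝔸ˣ) : 𝔸)) t₀)
include hU

omit [NormOneClass 𝔸] in
/-- [cite: Balaban1985Averaging, (9) p.18] one step of parallel transport of an analytic family of configurations is
analytic (elementary API). -/
theorem analyticAt_stepHol (x : Fin d → ℤ) (l : Letter d) :
    AnalyticAt ℂ (fun t => ((stepHol (Function.curry (U t)) x l : 𝔸ˣ) : 𝔸)) t₀ := by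
  obtain ⟨μ, b⟩ := l
  cases b
  · simp only [stepHol_false]
    exact analyticAt_units_inv (hU (x - e μ, μ))
  · simp only [stepHol_true]
    exact hU (x, μ)

omit [NormOneClass 𝔸] in
/-- [cite: Balaban1985Averaging, (9) p.18] **every contour transporter `U(Γ)` of an analytic family of configurations
is analytic** (finite products of analytic bond variables and their inverses). -/
theorem analyticAt_hol : ∀ (w : List (Letter d)) (x : Fin d → ℤ),
    AnalyticAt ℂ (fun t => ((hol (Function.curry (U t)) x w : 𝔸ˣ) : 𝔸)) t₀
  | [], x => by
      simp only [hol_nil, Units.val_one]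
      exact analyticAt_const
  | l :: w, x => by
      simp only [hol_cons, Units.val_mul]
      exact (analyticAt_stepHol U hU x l).fun_mul (analyticAt_hol w (x + l.vec))

omit [NormOneClass 𝔸] in
/-- [cite: Balaban1987RG1, p.252] the contour transporters `U(Γ^π_{q,x})` of the family `𝐆(q,x)` are analytic in
the configuration. -/
theorem analyticAt_permT (π : Equiv.Perm (Fin d)) (x : Fin d → ℤ) :
    AnalyticAt ℂ (fun t => ((permT L (U t) π x : 𝔸ˣ) : 𝔸)) t₀ := by
  unfold permT
  exact analyticAt_hol U hU _ _

omit [NormOneClass 𝔸] [CompleteSpace 𝔸] in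
/-- [cite: Balaban1987RG1, (0.12) p.254] the straight transporters `U([x, x + n e_μ])` are analytic in the
configuration. -/
theorem analyticAt_lineR (x : Fin d → ℤ) (μ : Fin d) (n : ℕ) :
    AnalyticAt ℂ (fun t => ((lineR (U t) x μ n : 𝔸ˣ) : 𝔸)) t₀ := by
  unfold lineR
  induction n with
  | zero =>
      simp only [pathProd_zero, Units.val_one]
      exact analyticAt_const
  | succ n ih =>
      simp only [pathProd_succ, Units.val_mul]
      exact ih.fun_mul (hU _)

omit [NormOneClass 𝔸] [CompleteSpace 𝔸] in
/-- [cite: Balaban1987RG1, (0.12) p.254] the coarse bond variable `U(c)` is analytic in the configuration. -/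
theorem analyticAt_Ustr (c : ZdEdge d) : AnalyticAt ℂ (fun t => ((Ustr L (U t) c : 𝔸ˣ) : 𝔸)) t₀ := by
  unfold Ustr
  exact analyticAt_lineR U hU _ _ _

/-! ## § 2  The averaged contour variable (0.11) is analytic in the configuration -/

omit [NormOneClass 𝔸] in
/-- [cite: Balaban1987RG1, (0.11) p.253] the relative contour family `{U(Γ^π_{q,x})U(Γ_{q,x})⁻¹}_π` is analytic
in the configuration (as a map into the finite product `Perm(Fin d) → 𝔸`). -/
theorem analyticAt_rel_permT (x : Fin d → ℤ) :
    AnalyticAt ℂ (fun t => rel (fun π : Equiv.Perm (Fin d) => permT L (U t) π x) 1) t₀ := by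
  have e' : (fun t => rel (fun π : Equiv.Perm (Fin d) => permT L (U t) π x) 1)
      = fun t π => ((permT L (U t) π x : 𝔸ˣ) : 𝔸) * (((permT L (U t) 1 x)⁻¹ : 𝔸ˣ) : 𝔸) := rfl
  rw [e']
  exact AnalyticAt.pi (f := fun π t => ((permT L (U t) π x : 𝔸ˣ) : 𝔸) * (((permT L (U t) 1 x)⁻¹ : 𝔸ˣ) : 𝔸))
    fun π => (analyticAt_permT U hU π x).fun_mul (analyticAt_units_inv (analyticAt_permT U hU 1 x))

/-- [cite: Balaban1987RG1, (0.11) p.253] **THE AVERAGED CONTOUR VARIABLE `𝐔(q,x)` IS AN ANALYTIC FUNCTION OF THE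
CONFIGURATION** — print's standing assumption «we assume that it [the average M] is an analytic function» (p. 253)
holds for the lineage's realisation of (0.10)/(0.11): at every analytic family `t ↦ U_t` whose member `U_{t₀}` is
`U1`-valued and `ε₀`-regular on the block of `x` with `(dL)²ε₀ < 1/100`, `t ↦ 𝐔_{U_t}(q,x)` is complex-analytic
at `t₀` (Federbush's solution of (0.10) is analytic in the family — the tree's analytic implicit function theorem
`BlockAveragingFederbushAnalytic.analyticAt_fedSol` — composed with the analytic relative contour family). -/
theorem analyticAt_Tavg (hL : 0 < L) (hU1 : ∀ b, U t₀ b ∈ U1 𝔸) {ε₀ : ℝ} (hε₀ : 0 ≤ ε₀)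
    (hsm : ((d : ℝ) * L) ^ 2 * ε₀ < 1 / 100)
    (h44 : ∀ (p : Fin d → ℤ) (i j : Fin d), i ≠ j →
      ‖((plaquetteHolonomyZd (U t₀) p i j : 𝔸ˣ) : 𝔸) - 1‖ ≤ ε₀)
    (x : Fin d → ℤ) : AnalyticAt ℂ (fun t => ((Tavg L (U t) x : 𝔸ˣ) : 𝔸)) t₀ := by
  haveI : NeZero L := ⟨hL.ne'⟩
  have hx : x ∈ blockSites L (blockMap L x) := (mem_blockSites_iff L _ x).2 rfl
  have hreg : ∀ π, ‖rel (fun π : Equiv.Perm (Fin d) => permT L (U t₀) π x) 1 π - 1‖ < 1 / 100 := fun π =>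
    (rel_permT_small hL (U t₀) (fun b => (mem_U1.mp (hU1 b)).1) (fun b => (mem_U1.mp (hU1 b)).2) hε₀ hx
      (fun p i j hij _ _ => h44 p i j hij) π).trans_lt hsm
  have e' : (fun t => ((Tavg L (U t) x : 𝔸ˣ) : 𝔸))
      = fun t => Ring.inverse (fedSol (rel (fun π : Equiv.Perm (Fin d) => permT L (U t) π x) 1))
          * ((permT L (U t) 1 x : 𝔸ˣ) : 𝔸) := by
    funext t
    rw [Tavg_eq hL, Units.val_mul, ← permT_one hL, ← val_fedUnit, Ring.inverse_unit]
  rw [e']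
  refine AnalyticAt.fun_mul ?_ (analyticAt_permT U hU 1 x)
  have hsol : AnalyticAt ℂ (fun t => fedSol (rel (fun π : Equiv.Perm (Fin d) => permT L (U t) π x) 1)) t₀ :=
    (analyticAt_fedSol hreg).fun_comp_of_eq (analyticAt_rel_permT U hU x) rfl
  have hinv := analyticAt_inverse (𝕜 := ℂ) (fedUnit (rel (fun π : Equiv.Perm (Fin d) => permT L (U t₀) π x) 1))
  rw [val_fedUnit] at hinv
  exact hinv.fun_comp_of_eq hsol rfl

/-! ## § 3  The (0.12) loops and the average (0.12) are analytic in the configuration -/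

/-- [cite: Balaban1987RG1, (0.12) p.254] the (0.12) loops `W^avg_x = 𝐔(c₋,x)U([x,x′])𝐔(c₊,x′)⁻¹U(c)⁻¹` are analytic
in the configuration (at regular `U1`-valued members, `(dL)²ε₀ < 1/100`). -/
theorem analyticAt_loopW_Tavg (hL : 0 < L) (hU1 : ∀ b, U t₀ b ∈ U1 𝔸) {ε₀ : ℝ} (hε₀ : 0 ≤ ε₀)
    (hsm : ((d : ℝ) * L) ^ 2 * ε₀ < 1 / 100)
    (h44 : ∀ (p : Fin d → ℤ) (i j : Fin d), i ≠ j →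
      ‖((plaquetteHolonomyZd (U t₀) p i j : 𝔸ˣ) : 𝔸) - 1‖ ≤ ε₀)
    (c : ZdEdge d) (x : Fin d → ℤ) :
    AnalyticAt ℂ (fun t => ((loopW L (fun U : ZdEdge d → 𝔸ˣ => Tavg L U) (U t) c x : 𝔸ˣ) : 𝔸)) t₀ := by
  have e' : (fun t => ((loopW L (fun U : ZdEdge d → 𝔸ˣ => Tavg L U) (U t) c x : 𝔸ˣ) : 𝔸)) = fun t =>
      ((Tavg L (U t) x : 𝔸ˣ) : 𝔸) * ((lineR (U t) x c.2 L : 𝔸ˣ) : 𝔸)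
        * (((Tavg L (U t) (x + Pi.single c.2 (L : ℤ)))⁻¹ : 𝔸ˣ) : 𝔸) * (((Ustr L (U t) c)⁻¹ : 𝔸ˣ) : 𝔸) := by
    funext t
    rw [loopW_def, Units.val_mul, Units.val_mul, Units.val_mul]
  have h1 : AnalyticAt ℂ (fun t => ((Tavg L (U t) x : 𝔸ˣ) : 𝔸)) t₀ := analyticAt_Tavg U hU hL hU1 hε₀ hsm h44 x
  have h2 : AnalyticAt ℂ (fun t => ((lineR (U t) x c.2 L : 𝔸ˣ) : 𝔸)) t₀ := analyticAt_lineR U hU x c.2 L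
  have h3 : AnalyticAt ℂ (fun t => (((Tavg L (U t) (x + Pi.single c.2 (L : ℤ)))⁻¹ : 𝔸ˣ) : 𝔸)) t₀ :=
    analyticAt_units_inv (analyticAt_Tavg U hU hL hU1 hε₀ hsm h44 _)
  have h4 : AnalyticAt ℂ (fun t => (((Ustr L (U t) c)⁻¹ : 𝔸ˣ) : 𝔸)) t₀ :=
    analyticAt_units_inv (analyticAt_Ustr U hU c)
  rw [e']
  exact ((h1.fun_mul h2).fun_mul h3).fun_mul h4

/-- [cite: Balaban1987RG1, (0.12) p.254][cite: Balaban1985Averaging, Prop.3 (121) p.36] **THE AVERAGE (0.12) OVER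
THE AVERAGED CONTOUR VARIABLES (0.11) IS AN ANALYTIC FUNCTION OF THE CONFIGURATION**: at every analytic family
`t ↦ U_t` of configurations whose member `U_{t₀}` is `U1`-valued and `ε₀`-regular with `(dL)²ε₀ < 1/100`
(`d ≥ 1`), `t ↦ Ū_{U_t}(c)` is complex-analytic at `t₀` — the analyticity clause of [B7] Proposition 3 («Q(V₀, A,
c) = (1/i) log (V̄₁)_c is an analytic function of A») for [I]'s actual average, before taking the logarithm:
composition of § 2 with the straight transporters, the series logarithm (analytic on `‖W − 1‖ < 1`, where the loops
lie: `ω_A = 10(dL)²ε₀ < 1`), the block sum and `exp`. -/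
theorem analyticAt_avgBar (hL : 0 < L) (hd : 1 ≤ d) (hU1 : ∀ b, U t₀ b ∈ U1 𝔸) {ε₀ : ℝ} (hε₀ : 0 ≤ ε₀)
    (hsm : ((d : ℝ) * L) ^ 2 * ε₀ < 1 / 100)
    (h44 : ∀ (p : Fin d → ℤ) (i j : Fin d), i ≠ j →
      ‖((plaquetteHolonomyZd (U t₀) p i j : 𝔸ˣ) : 𝔸) - 1‖ ≤ ε₀)
    (c : ZdEdge d) : AnalyticAt ℂ (fun t => ((avgBar L (U t) c : 𝔸ˣ) : 𝔸)) t₀ := by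
  have hloop : ∀ x ∈ blockSites L c.1,
      ‖((loopW L (fun U : ZdEdge d → 𝔸ˣ => Tavg L U) (U t₀) c x : 𝔸ˣ) : 𝔸) - 1‖ < 1 := by
    intro x hx
    have h := norm_loopW_Tavg_sub_one_le_local hL hd (U t₀) (fun b => (mem_U1.mp (hU1 b)).1)
      (fun b => (mem_U1.mp (hU1 b)).2) hε₀ hsm.le c (fun p i j hij _ _ => h44 p i j hij) hx
    have hω : omegaA d L ε₀ < 1 := by unfold omegaA; linarith
    exact h.trans_lt hω
  have e' : (fun t => ((avgBar L (U t) c : 𝔸ˣ) : 𝔸)) = fun t =>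
      exp (∑ x ∈ blockSites L c.1, ((L : ℂ) ^ d)⁻¹ •
        mlog ((loopW L (fun U : ZdEdge d → 𝔸ˣ => Tavg L U) (U t) c x : 𝔸ˣ) : 𝔸)) * ((Ustr L (U t) c : 𝔸ˣ) : 𝔸) := by
    funext t
    unfold avgBar avgM
    rw [Units.val_mul, val_expU]
  rw [e']
  refine AnalyticAt.fun_mul ?_ (analyticAt_Ustr U hU c)
  refine (exp_analytic _).fun_comp_of_eq ?_ rfl
  refine Finset.analyticAt_fun_sum _ fun x hx => ?_
  have hm : AnalyticAt ℂ (fun t => mlog ((loopW L (fun U : ZdEdge d → 𝔸ˣ => Tavg L U) (U t) c x : 𝔸ˣ) : 𝔸)) t₀ :=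
    (analyticAt_mlog (hloop x hx)).fun_comp_of_eq (analyticAt_loopW_Tavg U hU hL hU1 hε₀ hsm h44 c x) rfl
  exact (analyticAt_const (v := (((L : ℂ) ^ d)⁻¹ : ℂ))).smul hm

end Transport

/-! ## § 4  The perturbed configuration `V′V`, `V′ = exp(iB′)`, and (2.4)'s `Q̃_V(B′)` -/

section Perturbation

variable {t₀ : E}

omit [NormOneClass 𝔸] in
/-- [cite: Balaban1987RG1, p.265] the perturbed configuration `V′V⁽ᵏ⁾`, `V′ = exp(iB′)`, depends analytically on `B′`
(bondwise, through any analytic parametrisation `t ↦ B′_t`). -/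
theorem analyticAt_pert (B : E → ZdEdge d → 𝔸) (hB : ∀ b, AnalyticAt ℂ (fun t => B t b) t₀) (V : ZdEdge d → 𝔸ˣ)
    (b : ZdEdge d) : AnalyticAt ℂ (fun t => ((pert (B t) V b : 𝔸ˣ) : 𝔸)) t₀ := by
  simp only [pert_apply, Units.val_mul, val_expU]
  have hI : AnalyticAt ℂ (fun t => Complex.I • B t b) t₀ := (analyticAt_const (v := (Complex.I : ℂ))).smul (hB b)
  exact ((exp_analytic _).fun_comp_of_eq hI rfl).fun_mul analyticAt_const

/-- [cite: Balaban1987RG1, (2.4) p.266][cite: Balaban1985Averaging, Prop.3 (121) p.36] **`Q̃_V(B′)(c) = (1/i) log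
(Ū(V′V)(c)Ū(V)(c)⁻¹)` IS AN ANALYTIC FUNCTION OF `B′` NEAR `B′ = 0`** for [I]'s actual (0.12)/(0.11) average, at every
`U1`-valued `ε₀`-regular `V` with `(dL)²ε₀ < 1/100` (`d ≥ 1`): for every analytic parametrisation `t ↦ B′_t` with
`B′_{t₀} = 0`, `t ↦ Q̃_V(B′_t)(c)` is complex-analytic at `t₀` — [B7] Proposition 3's «Q(V₀, A, c) is an analytic
function of A» for the average (0.12) (the tree's `B12AverageCorridor267` DIVERGENCE (c) «Fréchet differentiability
of (2.4) in B′ … NOT proved» is discharged for the family (0.11)). -/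
theorem analyticAt_Qtilde (B : E → ZdEdge d → 𝔸) (hB : ∀ b, AnalyticAt ℂ (fun t => B t b) t₀) (hB0 : B t₀ = 0)
    (hL : 0 < L) (hd : 1 ≤ d) (V : ZdEdge d → 𝔸ˣ) (hV : ∀ b, V b ∈ U1 𝔸) {ε₀ : ℝ} (hε₀ : 0 ≤ ε₀)
    (hsm : ((d : ℝ) * L) ^ 2 * ε₀ < 1 / 100)
    (h44 : ∀ (p : Fin d → ℤ) (i j : Fin d), i ≠ j → ‖((plaquetteHolonomyZd V p i j : 𝔸ˣ) : 𝔸) - 1‖ ≤ ε₀)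
    (c : ZdEdge d) :
    AnalyticAt ℂ (fun t => Qtilde L (fun U : ZdEdge d → 𝔸ˣ => Tavg L U) V (B t) c) t₀ := by
  have hU : ∀ b, AnalyticAt ℂ (fun t => ((pert (B t) V b : 𝔸ˣ) : 𝔸)) t₀ := analyticAt_pert B hB V
  have hU0 : pert (B t₀) V = V := by rw [hB0, pert_zero]
  have hU1 : ∀ b, pert (B t₀) V b ∈ U1 𝔸 := fun b => by rw [hU0]; exact hV b
  have h44' : ∀ (p : Fin d → ℤ) (i j : Fin d), i ≠ j →
      ‖((plaquetteHolonomyZd (pert (B t₀) V) p i j : 𝔸ˣ) : 𝔸) - 1‖ ≤ ε₀ := by rw [hU0]; exact h44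
  have havg : AnalyticAt ℂ (fun t => ((avgBar L (pert (B t) V) c : 𝔸ˣ) : 𝔸)) t₀ :=
    analyticAt_avgBar (fun t => pert (B t) V) hU hL hd hU1 hε₀ hsm h44' c
  have e' : (fun t => Qtilde L (fun U : ZdEdge d → 𝔸ˣ => Tavg L U) V (B t) c)
      = fun t => (-Complex.I) • mlog (((avgBar L (pert (B t) V) c : 𝔸ˣ) : 𝔸) * (((avgBar L V c)⁻¹ : 𝔸ˣ) : 𝔸)) := by
    funext t
    unfold Qtilde
    rw [Units.val_mul]
    rfl
  rw [e']
  have harg : AnalyticAt ℂ (fun t => ((avgBar L (pert (B t) V) c : 𝔸ˣ) : 𝔸) * (((avgBar L V c)⁻¹ : 𝔸ˣ) : 𝔸)) t₀ :=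
    havg.fun_mul analyticAt_const
  have h1 : ‖((avgBar L (pert (B t₀) V) c : 𝔸ˣ) : 𝔸) * (((avgBar L V c)⁻¹ : 𝔸ˣ) : 𝔸) - 1‖ < 1 := by
    rw [hU0, Units.mul_inv, sub_self, norm_zero]
    exact one_pos
  have hm := (analyticAt_mlog h1).fun_comp_of_eq harg rfl
  exact (analyticAt_const (v := (-Complex.I : ℂ))).smul hm

end Perturbation

/-! ## § 5  The linear part `LQ̃` of p. 267 is LINEAR in `B′` -/

section Linear

variable {L : ℕ}

/-- [cite: Balaban1987RG1, p.267] along a line: `s ↦ Q̃_V(sB′)(c)` is complex-differentiable at `s = 0`, so the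
tree's `LQ L 𝐔 V B′ c := d/ds|₀ Q̃_V(sB′)(c)` is a genuine derivative (no junk value) for the family (0.11). -/
theorem hasDerivAt_Qtilde_line (hL : 0 < L) (hd : 1 ≤ d) (V : ZdEdge d → 𝔸ˣ) (hV : ∀ b, V b ∈ U1 𝔸) {ε₀ : ℝ}
    (hε₀ : 0 ≤ ε₀) (hsm : ((d : ℝ) * L) ^ 2 * ε₀ < 1 / 100)
    (h44 : ∀ (p : Fin d → ℤ) (i j : Fin d), i ≠ j → ‖((plaquetteHolonomyZd V p i j : 𝔸ˣ) : 𝔸) - 1‖ ≤ ε₀)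
    (B' : ZdEdge d → 𝔸) (c : ZdEdge d) :
    HasDerivAt (fun s : ℂ => Qtilde L (fun U : ZdEdge d → 𝔸ˣ => Tavg L U) V (s • B') c)
      (LQ L (fun U : ZdEdge d → 𝔸ˣ => Tavg L U) V B' c) 0 := by
  have han : AnalyticAt ℂ (fun s : ℂ => Qtilde L (fun U : ZdEdge d → 𝔸ˣ => Tavg L U) V (s • B') c) 0 :=
    analyticAt_Qtilde (fun s : ℂ => s • B') (fun b => (analyticAt_id).smul analyticAt_const) (zero_smul ℂ B')
      hL hd V hV hε₀ hsm h44 c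
  exact han.differentiableAt.hasDerivAt

/-- [cite: Balaban1987RG1, p.267] **`LQ̃` IS ADDITIVE IN `B′`** for [I]'s actual (0.12)/(0.11) average (at `U1`-valued
`ε₀`-regular `V`, `(dL)²ε₀ < 1/100`, `d ≥ 1`): `LQ̃(B′₁ + B′₂) = LQ̃B′₁ + LQ̃B′₂` — the two-parameter family
`(s, r) ↦ Q̃_V(sB′₁ + rB′₂)(c)` is analytic at `0`, and the three directional derivatives are values of one Fréchet
derivative (the tree's `B12AverageCorridor267` DIVERGENCE (c) «additivity of LQ̃ … NOT proved», discharged for the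
family (0.11)). -/
theorem LQ_add (hL : 0 < L) (hd : 1 ≤ d) (V : ZdEdge d → 𝔸ˣ) (hV : ∀ b, V b ∈ U1 𝔸) {ε₀ : ℝ} (hε₀ : 0 ≤ ε₀)
    (hsm : ((d : ℝ) * L) ^ 2 * ε₀ < 1 / 100)
    (h44 : ∀ (p : Fin d → ℤ) (i j : Fin d), i ≠ j → ‖((plaquetteHolonomyZd V p i j : 𝔸ˣ) : 𝔸) - 1‖ ≤ ε₀)
    (B₁ B₂ : ZdEdge d → 𝔸) (c : ZdEdge d) :
    LQ L (fun U : ZdEdge d → 𝔸ˣ => Tavg L U) V (B₁ + B₂) c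
      = LQ L (fun U : ZdEdge d → 𝔸ˣ => Tavg L U) V B₁ c + LQ L (fun U : ZdEdge d → 𝔸ˣ => Tavg L U) V B₂ c := by
  -- the two-parameter family
  set f : ℂ × ℂ → 𝔸 := fun p => Qtilde L (fun U : ZdEdge d → 𝔸ˣ => Tavg L U) V (p.1 • B₁ + p.2 • B₂) c with hf
  have han : AnalyticAt ℂ f 0 := by
    refine analyticAt_Qtilde (fun p : ℂ × ℂ => p.1 • B₁ + p.2 • B₂) (fun b => ?_) (by simp) hL hd V hV hε₀ hsm h44 c
    show AnalyticAt ℂ (fun p : ℂ × ℂ => p.1 • B₁ b + p.2 • B₂ b) 0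
    exact (((ContinuousLinearMap.fst ℂ ℂ ℂ).analyticAt 0).smul analyticAt_const).add
      (((ContinuousLinearMap.snd ℂ ℂ ℂ).analyticAt 0).smul analyticAt_const)
  have hfd : HasFDerivAt f (fderiv ℂ f 0) 0 := han.differentiableAt.hasFDerivAt
  -- the three curves through `0`
  have hγ : ∀ (a b : ℂ), HasDerivAt (fun s : ℂ => ((s * a, s * b) : ℂ × ℂ)) (a, b) 0 := fun a b => by
    have h1 : HasDerivAt (fun s : ℂ => s * a) a 0 := by simpa using (hasDerivAt_id (0 : ℂ)).mul_const a
    have h2 : HasDerivAt (fun s : ℂ => s * b) b 0 := by simpa using (hasDerivAt_id (0 : ℂ)).mul_const b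
    exact h1.prodMk h2
  have hcomp : ∀ (a b : ℂ), HasDerivAt (fun s : ℂ => f (s * a, s * b)) (fderiv ℂ f 0 (a, b)) 0 := fun a b => by
    have h0 : (fun s : ℂ => ((s * a, s * b) : ℂ × ℂ)) 0 = 0 := by simp
    have hfd' : HasFDerivAt f (fderiv ℂ f 0) ((fun s : ℂ => ((s * a, s * b) : ℂ × ℂ)) 0) := by rw [h0]; exact hfd
    exact hfd'.comp_hasDerivAt (0 : ℂ) (hγ a b)
  -- identify the directional derivatives with `LQ̃`
  have e12 : (fun s : ℂ => Qtilde L (fun U : ZdEdge d → 𝔸ˣ => Tavg L U) V (s • (B₁ + B₂)) c)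
      = fun s => f (s * 1, s * 1) := by
    funext s; simp only [hf, mul_one, smul_add]
  have e1 : (fun s : ℂ => Qtilde L (fun U : ZdEdge d → 𝔸ˣ => Tavg L U) V (s • B₁) c) = fun s => f (s * 1, s * 0) := by
    funext s; simp only [hf, mul_one, mul_zero, zero_smul, add_zero]
  have e2 : (fun s : ℂ => Qtilde L (fun U : ZdEdge d → 𝔸ˣ => Tavg L U) V (s • B₂) c) = fun s => f (s * 0, s * 1) := by
    funext s; simp only [hf, mul_one, mul_zero, zero_smul, zero_add]
  unfold LQ
  rw [e12, e1, e2, (hcomp 1 1).deriv, (hcomp 1 0).deriv, (hcomp 0 1).deriv, ← map_add, Prod.mk_add_mk, add_zero,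
    zero_add]

/-- [cite: Balaban1987RG1, p.267] **`LQ̃` IS HOMOGENEOUS IN `B′`**: `LQ̃(aB′) = a·LQ̃B′` (`a ∈ ℂ`), same setting. -/
theorem LQ_smul (hL : 0 < L) (hd : 1 ≤ d) (V : ZdEdge d → 𝔸ˣ) (hV : ∀ b, V b ∈ U1 𝔸) {ε₀ : ℝ} (hε₀ : 0 ≤ ε₀)
    (hsm : ((d : ℝ) * L) ^ 2 * ε₀ < 1 / 100)
    (h44 : ∀ (p : Fin d → ℤ) (i j : Fin d), i ≠ j → ‖((plaquetteHolonomyZd V p i j : 𝔸ˣ) : 𝔸) - 1‖ ≤ ε₀)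
    (a : ℂ) (B' : ZdEdge d → 𝔸) (c : ZdEdge d) :
    LQ L (fun U : ZdEdge d → 𝔸ˣ => Tavg L U) V (a • B') c = a • LQ L (fun U : ZdEdge d → 𝔸ˣ => Tavg L U) V B' c := by
  set g : ℂ → 𝔸 := fun u => Qtilde L (fun U : ZdEdge d → 𝔸ˣ => Tavg L U) V (u • B') c with hg
  have hgd : HasDerivAt g (LQ L (fun U : ZdEdge d → 𝔸ˣ => Tavg L U) V B' c) 0 :=
    hasDerivAt_Qtilde_line hL hd V hV hε₀ hsm h44 B' c
  have hh : HasDerivAt (fun s : ℂ => s * a) a 0 := by simpa using (hasDerivAt_id (0 : ℂ)).mul_const a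
  have h0 : (fun s : ℂ => s * a) 0 = 0 := by simp
  have hgd' : HasDerivAt g (LQ L (fun U : ZdEdge d → 𝔸ˣ => Tavg L U) V B' c) ((fun s : ℂ => s * a) 0) := by
    rw [h0]; exact hgd
  have hc := hgd'.scomp (0 : ℂ) hh
  have e' : (fun s : ℂ => Qtilde L (fun U : ZdEdge d → 𝔸ˣ => Tavg L U) V (s • (a • B')) c) = g ∘ fun s : ℂ => s * a := by
    funext s; simp only [hg, Function.comp_apply, smul_smul]
  show deriv (fun s : ℂ => Qtilde L (fun U : ZdEdge d → 𝔸ˣ => Tavg L U) V (s • (a • B')) c) 0 = _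
  rw [e', hc.deriv]

end Linear

end Literature.MathematicalPhysics.QuantumFieldTheory.Balaban1983to89.B12Average012Analytic

end
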